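import Mathlib
import Summits.Ventures.PercRepro2.K5HyperI

/-!
# THE `TvT-(i)` CERTIFICATES, PART A
(blind cell PercRepro2, typer-1 g10; mine-1 §23.5 — the (i)-side; twin `k5hyper_i_typer.py`, `0` violations)

One `decide +kernel` per triangle `T`: `CertLE (kNegTvTI a b c) (kPosTvTI a b c)` — `N⁽ⁱ⁾(H + △(1,1,1)) ≥ N⁽ⁱ⁾(H + T(1))` at every `K₅` profile.
-/

namespace Summit.Ventures.PercRepro2

namespace K5

set_option maxRecDepth 100000 in
/-- `TvT-(i) ≥ 0` on the triangle `T = {0, 1, 2}`. -/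
theorem cert_TvTI_012 : CertLE (kNegTvTI 0 1 2) (kPosTvTI 0 1 2) := by
  unfold CertLE
  decide +kernel

set_option maxRecDepth 100000 in
/-- `TvT-(i) ≥ 0` on the triangle `T = {0, 1, 3}`. -/
theorem cert_TvTI_013 : CertLE (kNegTvTI 0 1 3) (kPosTvTI 0 1 3) := by
  unfold CertLE
  decide +kernel

set_option maxRecDepth 100000 in
/-- `TvT-(i) ≥ 0` on the triangle `T = {0, 1, 4}`. -/
theorem cert_TvTI_014 : CertLE (kNegTvTI 0 1 4) (kPosTvTI 0 1 4) := by
  unfold CertLE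
  decide +kernel

set_option maxRecDepth 100000 in
/-- `TvT-(i) ≥ 0` on the triangle `T = {0, 2, 3}`. -/
theorem cert_TvTI_023 : CertLE (kNegTvTI 0 2 3) (kPosTvTI 0 2 3) := by
  unfold CertLE
  decide +kernel

end K5

end Summit.Ventures.PercRepro2
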